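import Mathlib.Data.Fintype.Perm
import Mathlib.Data.Fintype.Pi
import Mathlib.Algebra.BigOperators.Ring.Finset
import Mathlib.Algebra.Order.BigOperators.Group.Finset
import Mathlib.Order.PiLex
import Mathlib.Analysis.SpecialFunctions.Pow.Real
import Literature.Computability.QuantumComplexity.QueryComplexity
import HarnessLib

/-!
# Simon's problem: the classical query lower bound (decision version, deterministic trees)

Family `quantum-advantage` (trunk `CryptoQuantFine`), namespace `Literature.QuantumAdvantage.SimonLB`.
This file proves the distributional form of Simon's lower bound (Simon 1997, §3.2, Thm. 3.1:
"any PTM that queries the oracle no more than `2^{n/4}` times cannot correctly guess `b(n)` with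
probability greater than `1/2 + 2^{-n/2}`"; de Wolf 2019, §3.3.2, the decision version "decide
whether `s = 0ⁿ`"), in the form consumed by the oracle separation `BQP^A ⊄ BPP^A`
(`OracleSeparationBQPBPP.lean`): **a deterministic decision tree asking at most `T` point
queries `z ↦ f(z) ∈ {0,1}ⁿ` accepts a uniformly random permutation `f` of `{0,1}ⁿ` and a random
two-to-one function with a random nonzero xor-mask `s` with probabilities that differ by at most
`2T²/(2ⁿ - 1)`** (`SimonLB.abs_noProb_sub_yesProb_le`).

* `DTree Q A R` — deterministic decision trees (adaptive query algorithms) with queries `Q`,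
  answers `A`, results `R`; `DTree.run`, `DTree.queries`.
* `bxor`, `rep s` (the smaller of `x`, `x ⊕ s` in the lexicographic order), `twoToOne s g = g ∘ rep s`:
  for a permutation `g` and `s ≠ 0` this function has xor-mask `s`
  (`hasXorMask_twoToOne`, in the sense of `Literature.Computability.QuantumComplexity.HasXorMask` of
  `QueryComplexity.lean`); for `s = 0` it is `g` itself.
* The heart of the printed proof ("if the sequence of queries is bad [no two queries differ by
  `s`], then each sequence of `T` distinct outcomes is equally likely — just as in the `s = 0ⁿ`
  case", de Wolf; "`O`'s answers … reveal no information other than sameness or distinctness",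
  Simon) is the counting identity `cnt_mul_tot` (proved by induction on the tree, for partial
  transcripts `ρ`, via the value-swapping symmetry `tot_snoc_eq_of_not_mem`); the collision
  bound "`S_k` has only `k - 1` members" is `card_filter_bad_le`.

## References

* D. R. Simon, *On the power of quantum computation*, SIAM J. Comput. 26(5) (1997) 1474–1483
  (FOCS 1994, 116–123), §3.1–§3.2, Thm. 3.1, Thm. 3.2 (numbering of the FOCS 1994 text) [Simon1997].
* R. de Wolf, *Quantum Computing: Lecture Notes*, arXiv:1907.09415, §3.3.2 (classical lower
  bound for the decision version of Simon's problem) [deWolf2019].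
* E. Bernstein, U. Vazirani, *Quantum complexity theory*, SIAM J. Comput. 26 (1997), §8.4,
  Cor. 8.14 (the averaging over runs `∑_r Pr[r] Pr[correct | r]`) [BernsteinVazirani1997].
-/

namespace Literature.Computability.QuantumComplexity

namespace SimonLB

open Finset

/-! ### Deterministic decision trees with general queries -/

/-- A deterministic decision tree (adaptive query algorithm) asking queries in `Q`, receiving
answers in `A` and ending with a result in `R`. [Buhrman–de Wolf 2002, §2; de Wolf 2019, §3.3.2
("deterministic `T`-query algorithm")] [cite: deWolf2019, §3.3.2] -/
inductive DTree (Q A R : Type) : Type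
  /-- Stop with the result `r`. -/
  | leaf (r : R) : DTree Q A R
  /-- Ask the query `q` and continue with the subtree selected by the answer. -/
  | node (q : Q) (next : A → DTree Q A R) : DTree Q A R

namespace DTree

variable {Q A R : Type}

/-- The result of the tree on the input (black box) `f`. [cite: deWolf2019, §3.3.2] -/
def run (f : Q → A) : DTree Q A R → R
  | leaf r => r
  | node q next => run f (next (f q))

/-- The sequence of queries asked on the input `f`. [cite: deWolf2019, §3.3.2] -/
def queries (f : Q → A) : DTree Q A R → List Q
  | leaf _ => []
  | node q next => q :: queries f (next (f q))

/-- `run` at a leaf. [folklore] -/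
@[simp] theorem run_leaf (f : Q → A) (r : R) : (leaf r : DTree Q A R).run f = r := rfl
/-- `run` at a node. [folklore] -/
@[simp] theorem run_node (f : Q → A) (q : Q) (next : A → DTree Q A R) :
    (node q next).run f = (next (f q)).run f := rfl
/-- `queries` at a leaf. [folklore] -/
@[simp] theorem queries_leaf (f : Q → A) (r : R) : (leaf r : DTree Q A R).queries f = [] := rfl
/-- `queries` at a node. [folklore] -/
@[simp] theorem queries_node (f : Q → A) (q : Q) (next : A → DTree Q A R) :
    (node q next).queries f = q :: (next (f q)).queries f := rfl

/-- Post-processing the result of a tree. [folklore] -/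
def map {R' : Type} (φ : R → R') : DTree Q A R → DTree Q A R'
  | leaf r => leaf (φ r)
  | node q next => node q fun a => map φ (next a)

/-- `run` commutes with post-processing. [folklore] -/
@[simp] theorem run_map {R' : Type} (φ : R → R') (f : Q → A) :
    ∀ t : DTree Q A R, (t.map φ).run f = φ (t.run f)
  | leaf r => rfl
  | node q next => by simp only [map, run_node]; exact run_map φ f (next (f q))

/-- Post-processing does not change the queries. [folklore] -/
@[simp] theorem queries_map {R' : Type} (φ : R → R') (f : Q → A) :
    ∀ t : DTree Q A R, (t.map φ).queries f = t.queries f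
  | leaf r => rfl
  | node q next => by simp only [map, queries_node]; rw [queries_map φ f (next (f q))]

end DTree

/-! ### Bit vectors, xor, the representative map -/

/-- Bit strings of length `n` (points of `{0,1}ⁿ`). [folklore] -/
abbrev Bits (n : ℕ) : Type := Fin n → Bool

variable {n : ℕ}

/-- Bitwise xor. [folklore] -/
def bxor (a b : Bits n) : Bits n := fun i => a i ^^ b i

/-- `(a ⊕ s) ⊕ s = a`. [folklore] -/
@[simp] theorem bxor_bxor_cancel (a s : Bits n) : bxor (bxor a s) s = a := by
  funext i; simp [bxor]

/-- `a ⊕ 0 = a`. [folklore] -/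
@[simp] theorem bxor_zero (a : Bits n) : bxor a (fun _ => false) = a := by
  funext i; simp [bxor]

/-- `a ⊕ a = 0`. [folklore] -/
@[simp] theorem bxor_self (a : Bits n) : bxor a a = fun _ => false := by
  funext i; simp [bxor]

/-- Xor is commutative. [folklore] -/
theorem bxor_comm (a b : Bits n) : bxor a b = bxor b a := by
  funext i; simp [bxor, Bool.xor_comm]

/-- `a ⊕ s = b ↔ s = a ⊕ b`. [folklore] -/
theorem bxor_eq_iff (a s b : Bits n) : bxor a s = b ↔ s = bxor a b := by
  constructor
  · rintro rfl; funext i; simp [bxor]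
  · rintro rfl; funext i; simp [bxor]

/-- `a ⊕ s = a ↔ s = 0`. [folklore] -/
theorem bxor_eq_self_iff (a s : Bits n) : bxor a s = a ↔ s = fun _ => false := by
  rw [bxor_eq_iff, bxor_self]

/-- The representative of the pair `{x, x ⊕ s}`: its lexicographically smaller element.
[de Wolf 2019, §3.3.2 ("for each pair `(i, i ⊕ s)`")] [cite: deWolf2019, §3.3.2] -/
noncomputable def rep (s x : Bits n) : Bits n :=
  if toLex x ≤ toLex (bxor x s) then x else bxor x s

/-- The representative is one of `x`, `x ⊕ s`. [folklore] -/
theorem rep_eq_or (s x : Bits n) : rep s x = x ∨ rep s x = bxor x s := by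
  unfold rep; split_ifs <;> simp

/-- `x` and `x ⊕ s` have the same representative. [folklore] -/
theorem rep_bxor (s x : Bits n) : rep s (bxor x s) = rep s x := by
  unfold rep
  rw [bxor_bxor_cancel]
  by_cases h1 : toLex x ≤ toLex (bxor x s)
  · by_cases h2 : toLex (bxor x s) ≤ toLex x
    · have : toLex x = toLex (bxor x s) := le_antisymm h1 h2
      rw [if_pos h2, if_pos h1]; exact this.symm
    · rw [if_neg h2, if_pos h1]
  · have h2 : toLex (bxor x s) ≤ toLex x := le_of_not_ge h1
    rw [if_pos h2, if_neg h1]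

/-- Points with the same representative differ by `0` or by `s`. [folklore] -/
theorem eq_or_eq_bxor_of_rep_eq {s x x' : Bits n} (h : rep s x = rep s x') :
    x' = x ∨ x' = bxor x s := by
  rcases rep_eq_or s x with hx | hx <;> rcases rep_eq_or s x' with hx' | hx' <;> rw [hx, hx'] at h
  · exact Or.inl h.symm
  · right; rw [← bxor_bxor_cancel x' s, ← h]
  · exact Or.inr h.symm
  · left; have := congrArg (fun t => bxor t s) h; simpa using this.symm

/-- With the zero mask every point is its own representative. [folklore] -/
@[simp] theorem rep_zero (x : Bits n) : rep (fun _ => false) x = x := by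
  unfold rep; simp

/-- **The two-to-one function with mask `s` built from a permutation `g`**: `g ∘ rep s`
(for `s = 0` this is `g` itself). [de Wolf 2019, §3.3.2 ("for each pair `(i, i ⊕ s)`, we pick a
unique value … at random")] [cite: deWolf2019, §3.3.2] -/
noncomputable def twoToOne (s : Bits n) (g : Equiv.Perm (Bits n)) : Bits n → Bits n :=
  g ∘ rep s

/-- For a nonzero mask, `twoToOne s g` has xor-mask `s` in the sense of Simon's promise
(`HasXorMask`). [Simon 1997, §3.1] [cite: Simon1997, §3.1] -/
theorem hasXorMask_twoToOne {s : Bits n} (g : Equiv.Perm (Bits n)) :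
    HasXorMask (twoToOne s g) s := by
  intro x y
  simp only [twoToOne, Function.comp_apply, g.injective.eq_iff]
  constructor
  · intro h
    rcases eq_or_eq_bxor_of_rep_eq h with h' | h'
    · exact Or.inl h'
    · exact Or.inr (by rw [h']; rfl)
  · rintro (rfl | rfl)
    · rfl
    · exact (rep_bxor s x).symm

/-- With the zero mask, `twoToOne 0 g = g`. [folklore] -/
@[simp] theorem twoToOne_zero (g : Equiv.Perm (Bits n)) : twoToOne (fun _ => false) g = g := by
  funext x; simp [twoToOne]

/-! ### Bad transcripts, constrained permutations, the counting identity -/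

/-- A list of queried points is *bad for the mask `s`* ("good" in Simon's wording, "shows a
collision") if two of its points differ by `s`. [Simon 1997, §3.2 (proof of Thm. 3.1);
de Wolf 2019, §3.3.2] [cite: Simon1997, §3.2] -/
def Bad (s : Bits n) (L : List (Bits n)) : Prop := ∃ a ∈ L, ∃ b ∈ L, bxor a s = b

/-- Badness is monotone. [folklore] -/
theorem Bad.mono {s : Bits n} {L L' : List (Bits n)} (h : Bad s L) (hL : L ⊆ L') : Bad s L' := by
  obtain ⟨a, ha, b, hb, hab⟩ := h
  exact ⟨a, hL ha, b, hL hb, hab⟩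

/-- A function satisfies the partial transcript `ρ` (a list of query/answer pairs).
[de Wolf 2019, §3.3.2] [cite: deWolf2019, §3.3.2] -/
def Sat (h : Bits n → Bits n) (ρ : List (Bits n × Bits n)) : Prop := ∀ p ∈ ρ, h p.1 = p.2

/-- Satisfaction of an extended transcript. [folklore] -/
theorem sat_snoc (h : Bits n → Bits n) (ρ : List (Bits n × Bits n)) (x y : Bits n) :
    Sat h (ρ ++ [(x, y)]) ↔ Sat h ρ ∧ h x = y := by
  simp [Sat, or_imp, forall_and]

/-- A *world map* compatible with the mask `s`: points with the same image differ by `0` or `s`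
(the identity — the injective world — and `rep s` — the two-to-one world — are the two cases).
[folklore] -/
def WCompat (s : Bits n) (w : Bits n → Bits n) : Prop := ∀ a b, w a = w b → a = b ∨ a = bxor b s

/-- The identity is compatible with every mask. [folklore] -/
theorem wCompat_id (s : Bits n) : WCompat s id := fun _ _ h => Or.inl h

/-- `rep s` is compatible with `s`. [folklore] -/
theorem wCompat_rep (s : Bits n) : WCompat s (rep s) := fun _ _ h =>
  (eq_or_eq_bxor_of_rep_eq h.symm)

open scoped Classical in
/-- The number of permutations `g` with `g ∘ w` satisfying the transcript `ρ`. [de Wolf 2019,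
§3.3.2 ("each sequence of `T` distinct outcomes is equally likely")] [cite: deWolf2019, §3.3.2] -/
noncomputable def tot (w : Bits n → Bits n) (ρ : List (Bits n × Bits n)) : ℕ :=
  (univ.filter fun g : Equiv.Perm (Bits n) => Sat (g ∘ w) ρ).card

open scoped Classical in
/-- The number of permutations `g` with `g ∘ w` satisfying `ρ`, whose run of the tree `t` ends
in a result accepted by `E` and whose queries together with the transcript are not bad for `s`.
[cite: deWolf2019, §3.3.2] -/
noncomputable def cnt {R : Type} (w : Bits n → Bits n) (s : Bits n) (t : DTree (Bits n) (Bits n) R)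
    (E : R → Bool) (ρ : List (Bits n × Bits n)) : ℕ :=
  (univ.filter fun g : Equiv.Perm (Bits n) =>
    Sat (g ∘ w) ρ ∧ E (t.run (g ∘ w)) = true ∧
      ¬ Bad s (ρ.map Prod.fst ++ t.queries (g ∘ w))).card

/-- Partition of `tot` by the value at a new point. [folklore] -/
theorem tot_eq_sum (w : Bits n → Bits n) (ρ : List (Bits n × Bits n)) (x : Bits n) :
    tot w ρ = ∑ y, tot w (ρ ++ [(x, y)]) := by
  classical
  unfold tot
  rw [card_eq_sum_card_fiberwise (f := fun g : Equiv.Perm (Bits n) => g (w x)) (t := univ)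
    (fun _ _ => mem_coe.2 (mem_univ _))]
  refine sum_congr rfl fun y _ => ?_
  rw [filter_filter]
  congr 1
  ext g
  simp only [mem_filter, mem_univ, true_and, sat_snoc, Function.comp_apply]

/-- Partition of `cnt` at a node by the answer to its query. [folklore] -/
theorem cnt_node_eq_sum {R : Type} (w : Bits n → Bits n) (s : Bits n) (x : Bits n)
    (next : Bits n → DTree (Bits n) (Bits n) R) (E : R → Bool) (ρ : List (Bits n × Bits n)) :
    cnt w s (DTree.node x next) E ρ = ∑ y, cnt w s (next y) E (ρ ++ [(x, y)]) := by
  classical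
  unfold cnt
  rw [card_eq_sum_card_fiberwise (f := fun g : Equiv.Perm (Bits n) => g (w x)) (t := univ)
    (fun _ _ => mem_coe.2 (mem_univ _))]
  refine sum_congr rfl fun y _ => ?_
  rw [filter_filter]
  congr 1
  ext g
  simp only [mem_filter, mem_univ, true_and, sat_snoc, Function.comp_apply, DTree.run_node,
    DTree.queries_node, List.map_append, List.map_cons, List.map_nil, List.append_assoc,
    List.singleton_append]
  constructor
  · rintro ⟨⟨h1, h2, h3⟩, h4⟩
    refine ⟨⟨h1, h4⟩, ?_, ?_⟩
    · simpa [h4] using h2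
    · simpa [h4] using h3
  · rintro ⟨⟨h1, h4⟩, h2, h3⟩
    refine ⟨⟨h1, ?_, ?_⟩, h4⟩
    · simpa [h4] using h2
    · simpa [h4] using h3

/-- `cnt ≤ tot`. [folklore] -/
theorem cnt_le_tot {R : Type} (w : Bits n → Bits n) (s : Bits n) (t : DTree (Bits n) (Bits n) R)
    (E : R → Bool) (ρ : List (Bits n × Bits n)) : cnt w s t E ρ ≤ tot w ρ := by
  classical
  unfold cnt tot
  exact card_le_card (fun g => by simp only [mem_filter, mem_univ, true_and]; exact fun h => h.1)

/-- If the transcript already determines the value at `x`, extending it by `(x, y)` keeps all or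
nothing. [folklore] -/
theorem tot_snoc_of_mem (w : Bits n → Bits n) {ρ : List (Bits n × Bits n)} {x x₀ y₀ : Bits n}
    (hx : (x₀, y₀) ∈ ρ) (hw : w x₀ = w x) (y : Bits n) :
    tot w (ρ ++ [(x, y)]) = if y = y₀ then tot w ρ else 0 := by
  classical
  unfold tot
  split_ifs with hy
  · congr 1; ext g
    simp only [mem_filter, mem_univ, true_and, sat_snoc, Function.comp_apply, and_iff_left_iff_imp]
    intro h; rw [← hw, hy]; exact h _ hx
  · rw [card_eq_zero, filter_eq_empty_iff]
    intro g _ h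
    rw [sat_snoc] at h
    apply hy
    rw [← h.2, Function.comp_apply, ← hw]
    exact h.1 _ hx

/-- A value already used by the transcript cannot be the value at a point with a fresh image.
[de Wolf 2019, §3.3.2 ("`T` distinct outcomes")] [cite: deWolf2019, §3.3.2] -/
theorem tot_snoc_eq_zero (w : Bits n → Bits n) {ρ : List (Bits n × Bits n)} {x x₀ y : Bits n}
    (hx : (x₀, y) ∈ ρ) (hw : w x₀ ≠ w x) : tot w (ρ ++ [(x, y)]) = 0 := by
  classical
  unfold tot
  rw [card_eq_zero, filter_eq_empty_iff]
  intro g _ h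
  rw [sat_snoc] at h
  have h1 : g (w x₀) = y := h.1 _ hx
  have h2 : g (w x) = y := h.2
  exact hw (g.injective (h1.trans h2.symm))

/-- **Fresh values are interchangeable**: for two values not used by the transcript, the numbers
of compatible permutations taking them at a new point agree (compose with the transposition of
the two values). [Simon 1997, §3.2 ("completely random distinct values for each distinct query");
de Wolf 2019, §3.3.2] [cite: Simon1997, §3.2] -/
theorem tot_snoc_eq_of_not_mem (w : Bits n → Bits n) {ρ : List (Bits n × Bits n)} (x : Bits n)
    {y y' : Bits n} (hy : y ∉ ρ.map Prod.snd) (hy' : y' ∉ ρ.map Prod.snd) :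
    tot w (ρ ++ [(x, y)]) = tot w (ρ ++ [(x, y')]) := by
  classical
  unfold tot
  refine card_equiv (Equiv.mulLeft (Equiv.swap y y')) fun g => ?_
  simp only [mem_filter, mem_univ, true_and, sat_snoc, Equiv.coe_mulLeft]
  have hfix : ∀ p ∈ ρ, Equiv.swap y y' p.2 = p.2 := by
    intro p hp
    apply Equiv.swap_apply_of_ne_of_ne
    · rintro rfl; exact hy (List.mem_map.2 ⟨p, hp, rfl⟩)
    · rintro rfl; exact hy' (List.mem_map.2 ⟨p, hp, rfl⟩)
  constructor
  · rintro ⟨h1, h2⟩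
    refine ⟨fun p hp => ?_, ?_⟩
    · change Equiv.swap y y' (g (w p.1)) = p.2
      rw [show g (w p.1) = p.2 from h1 p hp, hfix p hp]
    · change Equiv.swap y y' (g (w x)) = y'
      rw [show g (w x) = y from h2, Equiv.swap_apply_left]
  · rintro ⟨h1, h2⟩
    refine ⟨fun p hp => ?_, ?_⟩
    · have h3 : Equiv.swap y y' (g (w p.1)) = p.2 := h1 p hp
      rw [← hfix p hp] at h3
      exact (Equiv.swap y y').injective h3
    · have h3 : Equiv.swap y y' (g (w x)) = y' := h2
      have : Equiv.swap y y' (g (w x)) = Equiv.swap y y' y := by rw [h3, Equiv.swap_apply_left]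
      exact (Equiv.swap y y').injective this

/-- The cross-ratio identity behind the induction: for two worlds compatible with `s` and a
point `x` keeping the transcript free of `s`-collisions,
`tot w (ρx↦y) · tot w' (ρx↦y') = tot w' (ρx↦y) · tot w (ρx↦y')`. [cite: deWolf2019, §3.3.2] -/
theorem tot_snoc_mul_comm {s : Bits n} {w w' : Bits n → Bits n} (hw : WCompat s w)
    (hw' : WCompat s w') {ρ : List (Bits n × Bits n)} {x : Bits n}
    (hB : ¬ Bad s (ρ.map Prod.fst ++ [x])) (y y' : Bits n) :
    tot w (ρ ++ [(x, y)]) * tot w' (ρ ++ [(x, y')]) =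
      tot w' (ρ ++ [(x, y)]) * tot w (ρ ++ [(x, y')]) := by
  classical
  by_cases hx : x ∈ ρ.map Prod.fst
  · -- the value at `x` is already determined (by the first occurrence)
    obtain ⟨p, hp, hpx⟩ := List.mem_map.1 hx
    obtain ⟨x₀, y₀⟩ := p
    dsimp only at hpx
    subst hpx
    rw [tot_snoc_of_mem w hp rfl, tot_snoc_of_mem w hp rfl, tot_snoc_of_mem w' hp rfl,
      tot_snoc_of_mem w' hp rfl]
    split_ifs <;> ring
  · -- `x` is fresh, and so is `x ⊕ s` (no collision)
    have hxs : ∀ x₀, x₀ ∈ ρ.map Prod.fst → x₀ ≠ x ∧ x₀ ≠ bxor x s := by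
      intro x₀ hx₀
      refine ⟨fun h => hx (h ▸ hx₀), fun h => hB ?_⟩
      refine ⟨x₀, List.mem_append_left _ hx₀, x, List.mem_append_right _ (List.mem_singleton_self _), ?_⟩
      rw [h, bxor_bxor_cancel]
    have hfresh : ∀ (v : Bits n → Bits n), WCompat s v → ∀ x₀, x₀ ∈ ρ.map Prod.fst → v x₀ ≠ v x := by
      intro v hv x₀ hx₀ h
      rcases hv x₀ x h with h' | h'
      · exact (hxs x₀ hx₀).1 h'
      · exact (hxs x₀ hx₀).2 h'
    -- values used by the transcript are impossible at `x`
    have hzero : ∀ (v : Bits n → Bits n), WCompat s v → ∀ y₁, y₁ ∈ ρ.map Prod.snd →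
        tot v (ρ ++ [(x, y₁)]) = 0 := by
      intro v hv y₁ hy₁
      obtain ⟨p, hp, hpy⟩ := List.mem_map.1 hy₁
      obtain ⟨x₀, y₀⟩ := p
      dsimp only at hpy
      subst hpy
      exact tot_snoc_eq_zero v hp (hfresh v hv x₀ (List.mem_map.2 ⟨_, hp, rfl⟩))
    by_cases hy : y ∈ ρ.map Prod.snd
    · rw [hzero w hw y hy, hzero w' hw' y hy]; ring
    by_cases hy' : y' ∈ ρ.map Prod.snd
    · rw [hzero w hw y' hy', hzero w' hw' y' hy']; ring
    rw [tot_snoc_eq_of_not_mem w x hy hy', tot_snoc_eq_of_not_mem w' x hy hy']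
    ring

/-- A small cancellation lemma on natural numbers. [folklore] -/
theorem cross_mul_eq {a a' A B A' B' : ℕ} (ha : a ≤ A) (ha' : a' ≤ B) (h1 : a * B = a' * A)
    (h2 : A * B' = B * A') : a * B' = a' * A' := by
  rcases Nat.eq_zero_or_pos A with hA | hA
  · subst hA
    have ha0 : a = 0 := Nat.le_zero.1 ha
    subst ha0
    simp only [zero_mul] at h2 ⊢
    rcases mul_eq_zero.1 h2.symm with hB | hA'
    · subst hB; have := Nat.le_zero.1 ha'; subst this; simp
    · subst hA'; simp
  rcases Nat.eq_zero_or_pos B with hB | hB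
  · subst hB
    have : a' = 0 := Nat.le_zero.1 ha'
    subst this
    simp only [mul_zero, zero_mul] at h1 h2 ⊢
    rcases mul_eq_zero.1 h2 with hA0 | hB'
    · omega
    · subst hB'; simp
  have key : a * B' * (A * B) = a' * A' * (A * B) := by
    calc a * B' * (A * B) = (a * B) * (A * B') := by ring
      _ = (a' * A) * (B * A') := by rw [h1, h2]
      _ = a' * A' * (A * B) := by ring
  exact Nat.eq_of_mul_eq_mul_right (Nat.mul_pos hA hB) key

/-- **The counting identity** (the core of Simon's and de Wolf's argument, made exact): for two
worlds `w`, `w'` compatible with the mask `s`, the number of permutations whose non-colliding run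
is accepted, relative to the number of permutations compatible with the transcript, is the same in
both worlds: `cnt w · tot w' = cnt w' · tot w`. With `w = id` (a random permutation, `s`-case
"`s = 0ⁿ`") and `w' = rep s` (a random two-to-one function with mask `s`) and the empty transcript
this says that accepted non-colliding runs are equinumerous in the two cases. [Simon 1997, §3.2,
proof of Thm. 3.1; de Wolf 2019, §3.3.2] [cite: Simon1997, §3.2, Thm. 3.1 (proof)] -/
theorem cnt_mul_tot {R : Type} {s : Bits n} {w w' : Bits n → Bits n} (hw : WCompat s w)
    (hw' : WCompat s w') (E : R → Bool) :
    ∀ (t : DTree (Bits n) (Bits n) R) (ρ : List (Bits n × Bits n)),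
      cnt w s t E ρ * tot w' ρ = cnt w' s t E ρ * tot w ρ
  | DTree.leaf r, ρ => by
    classical
    unfold cnt tot
    simp only [DTree.run_leaf, DTree.queries_leaf, List.append_nil]
    by_cases hE : E r = true
    · by_cases hB : Bad s (ρ.map Prod.fst)
      · simp [hE, hB]
      · simp only [hE, hB, not_false_eq_true, and_true]
        ring
    · simp [hE]
  | DTree.node x next, ρ => by
    classical
    by_cases hB : Bad s (ρ.map Prod.fst ++ [x])
    · -- a collision: no run is counted on either side
      have h0 : ∀ v : Bits n → Bits n, cnt v s (DTree.node x next) E ρ = 0 := by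
        intro v
        unfold cnt
        rw [card_eq_zero, filter_eq_empty_iff]
        rintro g - ⟨-, -, h3⟩
        refine h3 (hB.mono ?_)
        simp only [DTree.queries_node]
        intro a ha
        rcases List.mem_append.1 ha with ha | ha
        · exact List.mem_append_left _ ha
        · rw [List.mem_singleton] at ha
          exact List.mem_append_right _ (ha ▸ List.mem_cons_self)
      rw [h0 w, h0 w']; simp
    · rw [cnt_node_eq_sum, cnt_node_eq_sum, tot_eq_sum w ρ x, tot_eq_sum w' ρ x]
      simp only [sum_mul, mul_sum]
      refine sum_congr rfl fun y _ => sum_congr rfl fun y' _ => ?_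
      -- termwise: `cnt w (next y) ρy * tot w' ρy' = cnt w' (next y) ρy * tot w ρy'`
      have ih := cnt_mul_tot hw hw' E (next y') (ρ ++ [(x, y')])
      have hc := tot_snoc_mul_comm hw hw' hB y' y
      exact cross_mul_eq (cnt_le_tot _ _ _ _ _) (cnt_le_tot _ _ _ _ _) ih hc

/-! ### Probabilities: the injective world versus the two-to-one world -/

open scoped Classical in
/-- The number of permutations `g` such that the run of `t` on `g ∘ w` is accepted by `E`.
[cite: deWolf2019, §3.3.2] -/
noncomputable def acc {R : Type} (w : Bits n → Bits n) (t : DTree (Bits n) (Bits n) R)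
    (E : R → Bool) : ℕ :=
  (univ.filter fun g : Equiv.Perm (Bits n) => E (t.run (g ∘ w)) = true).card

open scoped Classical in
/-- The number of permutations `g` such that the queries of `t` on `g ∘ w` collide under `s`.
[cite: deWolf2019, §3.3.2] -/
noncomputable def bad {R : Type} (w : Bits n → Bits n) (s : Bits n) (t : DTree (Bits n) (Bits n) R) : ℕ :=
  (univ.filter fun g : Equiv.Perm (Bits n) => Bad s (t.queries (g ∘ w))).card

/-- `tot` of the empty transcript is the number of all permutations. [folklore] -/
theorem tot_nil (w : Bits n → Bits n) : tot w [] = Fintype.card (Equiv.Perm (Bits n)) := by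
  classical
  unfold tot
  rw [filter_true_of_mem (fun g _ => by simp [Sat]), card_univ]

/-- Accepted runs split into colliding and non-colliding ones. [folklore] -/
theorem acc_eq_cnt_add {R : Type} (w : Bits n → Bits n) (s : Bits n) (t : DTree (Bits n) (Bits n) R)
    (E : R → Bool) :
    ∃ b : ℕ, b ≤ bad w s t ∧ acc w t E = cnt w s t E [] + b := by
  classical
  refine ⟨(univ.filter fun g : Equiv.Perm (Bits n) =>
      E (t.run (g ∘ w)) = true ∧ Bad s (t.queries (g ∘ w))).card, ?_, ?_⟩
  · unfold bad
    exact card_le_card fun g => by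
      simp only [mem_filter, mem_univ, true_and]; exact fun h => h.2
  · unfold acc cnt
    rw [← card_union_of_disjoint]
    · congr 1
      ext g
      simp only [mem_filter, mem_univ, true_and, Sat, List.not_mem_nil, false_imp_iff,
        imp_true_iff, List.map_nil, List.nil_append, mem_union]
      tauto
    · rw [disjoint_filter]
      rintro g - ⟨-, -, h⟩ ⟨-, h'⟩
      simp only [List.map_nil, List.nil_append] at h
      exact h h'

/-- In both worlds the non-colliding runs are equinumerous, in total and among the accepted
ones. [cite: Simon1997, §3.2, Thm. 3.1 (proof)] -/
theorem cnt_nil_eq {R : Type} {s : Bits n} {w w' : Bits n → Bits n} (hw : WCompat s w)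
    (hw' : WCompat s w') (t : DTree (Bits n) (Bits n) R) (E : R → Bool) :
    cnt w s t E [] = cnt w' s t E [] := by
  have h := cnt_mul_tot hw hw' E t []
  rw [tot_nil, tot_nil] at h
  exact Nat.eq_of_mul_eq_mul_right Fintype.card_pos h

/-- The number of colliding runs is the same in both worlds. [cite: Simon1997, §3.2, Thm. 3.1 (proof)] -/
theorem bad_eq {R : Type} {s : Bits n} {w w' : Bits n → Bits n} (hw : WCompat s w)
    (hw' : WCompat s w') (t : DTree (Bits n) (Bits n) R) : bad w s t = bad w' s t := by
  classical
  -- non-colliding runs (accepted by everything) are equinumerous; complements then agree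
  have h := cnt_nil_eq hw hw' t (fun _ => true)
  have hc : ∀ v : Bits n → Bits n, cnt v s t (fun _ => true) [] + bad v s t =
      Fintype.card (Equiv.Perm (Bits n)) := by
    intro v
    unfold cnt bad
    have e : (univ.filter fun g : Equiv.Perm (Bits n) => Sat (g ∘ v) [] ∧
        (fun _ : R => true) (t.run (g ∘ v)) = true ∧
          ¬ Bad s (([] : List (Bits n × Bits n)).map Prod.fst ++ t.queries (g ∘ v))) =
        univ.filter fun g : Equiv.Perm (Bits n) => ¬ Bad s (t.queries (g ∘ v)) := by
      refine filter_congr fun g _ => ?_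
      simp [Sat]
    rw [e, add_comm, ← card_univ]
    exact card_filter_add_card_filter_not _
  have h1 := hc w
  have h2 := hc w'
  omega

/-- **Simon's indistinguishability bound for one mask**: the numbers of accepted permutations in
the injective world and in the two-to-one world with mask `s` differ by at most twice the number
of colliding runs. [Simon 1997, §3.2, proof of Thm. 3.1; de Wolf 2019, §3.3.2] [cite: Simon1997, §3.2, Thm. 3.1 (proof)] -/
theorem acc_sub_acc_le {R : Type} {s : Bits n} {w w' : Bits n → Bits n} (hw : WCompat s w)
    (hw' : WCompat s w') (t : DTree (Bits n) (Bits n) R) (E : R → Bool) :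
    |(acc w t E : ℤ) - acc w' t E| ≤ 2 * bad w s t := by
  obtain ⟨b, hb, h1⟩ := acc_eq_cnt_add w s t E
  obtain ⟨b', hb', h2⟩ := acc_eq_cnt_add w' s t E
  rw [h1, h2, cnt_nil_eq hw hw' t E, ← bad_eq hw hw' t] at *
  rw [abs_le]
  push_cast
  constructor <;> linarith [(Nat.cast_le (α := ℤ)).2 hb, (Nat.cast_le (α := ℤ)).2 hb',
    Nat.cast_nonneg (α := ℤ) b, Nat.cast_nonneg (α := ℤ) b']

/-! ### Counting collisions: a transcript of length `T` is bad for at most `T²` masks -/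

/-- The masks for which a list of points is bad are among the pairwise xors of its points, so
there are at most `|L|²` of them. [Simon 1997, §3.2 ("the number of distinct values of `s` for
which the queries might be good is less than `k²`"); de Wolf 2019, §3.3.2] [cite: Simon1997, §3.2] -/
theorem card_filter_bad_le (L : List (Bits n)) [DecidablePred fun s : Bits n => Bad s L] :
    (univ.filter fun s : Bits n => Bad s L).card ≤ L.length ^ 2 := by
  classical
  calc (univ.filter fun s : Bits n => Bad s L).card
      ≤ ((L.toFinset ×ˢ L.toFinset).image fun p => bxor p.1 p.2).card := by
        refine card_le_card fun s hs => ?_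
        simp only [mem_filter, mem_univ, true_and] at hs
        obtain ⟨a, ha, b, hb, hab⟩ := hs
        refine mem_image.2 ⟨(a, b), mem_product.2 ⟨List.mem_toFinset.2 ha, List.mem_toFinset.2 hb⟩, ?_⟩
        exact ((bxor_eq_iff a s b).1 hab).symm
    _ ≤ (L.toFinset ×ˢ L.toFinset).card := card_image_le
    _ = L.toFinset.card * L.toFinset.card := card_product _ _
    _ ≤ L.length * L.length := Nat.mul_le_mul (List.toFinset_card_le L) (List.toFinset_card_le L)
    _ = L.length ^ 2 := (sq _).symm

/-- Summing the collision counts over all masks: if every run asks at most `T` queries then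
`∑ₛ bad id s t ≤ T² · |Perm|`. [cite: deWolf2019, §3.3.2] -/
theorem sum_bad_le {R : Type} (t : DTree (Bits n) (Bits n) R) {T : ℕ}
    (hT : ∀ f : Bits n → Bits n, (t.queries f).length ≤ T) :
    ∑ s, bad id s t ≤ T ^ 2 * Fintype.card (Equiv.Perm (Bits n)) := by
  classical
  unfold bad
  simp only [Function.comp_id, card_eq_sum_ones, sum_filter]
  rw [sum_comm]
  calc ∑ g : Equiv.Perm (Bits n), ∑ s : Bits n, (if Bad s (t.queries g) then 1 else 0)
      ≤ ∑ _g : Equiv.Perm (Bits n), T ^ 2 := by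
        refine sum_le_sum fun g _ => ?_
        rw [← sum_filter, ← card_eq_sum_ones]
        exact (card_filter_bad_le _).trans (Nat.pow_le_pow_left (hT g) 2)
    _ = T ^ 2 * Fintype.card (Equiv.Perm (Bits n)) := by
        rw [sum_const, card_univ, smul_eq_mul, mul_comm]

/-! ### The distributional bound -/

/-- The probability that the tree accepts a uniformly random permutation of `{0,1}ⁿ` (the
injective world, "`s = 0ⁿ`"). [de Wolf 2019, §3.3.2 (the distribution `μ`, first half)] [cite: deWolf2019, §3.3.2] -/
noncomputable def noProb {R : Type} (t : DTree (Bits n) (Bits n) R) (E : R → Bool) : ℝ :=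
  (acc id t E : ℝ) / Fintype.card (Equiv.Perm (Bits n))

open scoped Classical in
/-- The probability that the tree accepts `twoToOne s g` for a uniformly random nonzero mask `s`
and a uniformly random permutation `g` (the two-to-one world; de Wolf's `μ`, second half).
[de Wolf 2019, §3.3.2] [cite: deWolf2019, §3.3.2] -/
noncomputable def yesProb {R : Type} (t : DTree (Bits n) (Bits n) R) (E : R → Bool) : ℝ :=
  (∑ s ∈ univ.filter (fun s : Bits n => s ≠ fun _ => false), (acc (rep s) t E : ℝ)) /
    ((2 ^ n - 1) * Fintype.card (Equiv.Perm (Bits n)))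

/-- `acc (rep s) t E` counts the permutations `g` for which `twoToOne s g` is accepted. [folklore] -/
theorem acc_rep_eq {R : Type} (s : Bits n) (t : DTree (Bits n) (Bits n) R) (E : R → Bool) :
    acc (rep s) t E =
      (univ.filter fun g : Equiv.Perm (Bits n) => E (t.run (twoToOne s g)) = true).card := by
  rfl

/-- There are `2ⁿ - 1` nonzero masks. [folklore] -/
theorem card_filter_ne_zero :
    ((univ.filter fun s : Bits n => s ≠ fun _ => false).card : ℝ) = 2 ^ n - 1 := by
  classical
  have h : (univ.filter fun s : Bits n => s ≠ fun _ => false) = univ.erase (fun _ => false) := by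
    ext s; simp [mem_erase, and_comm]
  rw [h, card_erase_of_mem (mem_univ _), card_univ, Fintype.card_fun, Fintype.card_bool,
    Fintype.card_fin]
  have : 1 ≤ 2 ^ n := Nat.one_le_two_pow
  push_cast [Nat.cast_sub this]
  ring

/-- **Simon's lower bound, distributional form** (Simon 1997, §3.2, Thm. 3.1; de Wolf 2019,
§3.3.2). A deterministic decision tree asking at most `T` point queries on every input accepts a
uniformly random permutation of `{0,1}ⁿ` and a random two-to-one function with a random nonzero
xor-mask with probabilities differing by at most `2T² / (2ⁿ - 1)`: a `T`-query algorithm "cannot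
'see' the difference between the `s = 0ⁿ` case and the `s ≠ 0ⁿ` case" unless its queries collide,
which happens with probability at most `∑ₖ (k-1)/(2ⁿ - 1 - …)`. (We bound the collision
probability by the cruder `T²/(2ⁿ - 1)`, in each of the two worlds.) [cite: Simon1997, §3.2, Thm. 3.1] [cite: deWolf2019, §3.3.2] -/
theorem abs_noProb_sub_yesProb_le {R : Type} (hn : 1 ≤ n) (t : DTree (Bits n) (Bits n) R)
    (E : R → Bool) {T : ℕ} (hT : ∀ f : Bits n → Bits n, (t.queries f).length ≤ T) :
    |noProb t E - yesProb t E| ≤ 2 * (T : ℝ) ^ 2 / (2 ^ n - 1) := by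
  classical
  set P : ℕ := Fintype.card (Equiv.Perm (Bits n)) with hP
  have hP0 : (0 : ℝ) < P := by exact_mod_cast (Fintype.card_pos : 0 < P)
  have hM : (0 : ℝ) < 2 ^ n - 1 := by
    have : (2 : ℝ) ≤ 2 ^ n := by
      calc (2 : ℝ) = 2 ^ 1 := by norm_num
        _ ≤ 2 ^ n := pow_le_pow_right₀ (by norm_num) hn
    linarith
  set S := univ.filter (fun s : Bits n => s ≠ fun _ => false) with hS
  have hScard : (S.card : ℝ) = 2 ^ n - 1 := card_filter_ne_zero
  -- rewrite the difference as an average over nonzero masks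
  have hno : noProb t E = (∑ s ∈ S, (acc id t E : ℝ)) / ((2 ^ n - 1) * P) := by
    rw [sum_const, nsmul_eq_mul, hScard, noProb, mul_div_mul_left _ _ hM.ne']
  have hdiff : noProb t E - yesProb t E =
      (∑ s ∈ S, ((acc id t E : ℝ) - acc (rep s) t E)) / ((2 ^ n - 1) * P) := by
    rw [hno, yesProb, ← sub_div, sum_sub_distrib]
  rw [hdiff, abs_div, abs_of_pos (mul_pos hM hP0)]
  -- bound each term by twice the collision count, then sum the collision counts
  have hterm : ∀ s ∈ S, |(acc id t E : ℝ) - acc (rep s) t E| ≤ 2 * (bad id s t : ℝ) := by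
    intro s _
    have h := acc_sub_acc_le (wCompat_id s) (wCompat_rep s) t E
    have h' : ((|(acc id t E : ℤ) - acc (rep s) t E| : ℤ) : ℝ) ≤ ((2 * bad id s t : ℤ) : ℝ) := by
      exact_mod_cast h
    push_cast at h'
    exact h'
  have hbad : ∑ s, (bad id s t : ℝ) ≤ (T : ℝ) ^ 2 * P := by
    have h := sum_bad_le t hT
    exact_mod_cast h
  have hsum : |∑ s ∈ S, ((acc id t E : ℝ) - acc (rep s) t E)| ≤ 2 * ((T : ℝ) ^ 2 * P) := by
    calc |∑ s ∈ S, ((acc id t E : ℝ) - acc (rep s) t E)|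
        ≤ ∑ s ∈ S, |(acc id t E : ℝ) - acc (rep s) t E| := abs_sum_le_sum_abs _ _
      _ ≤ ∑ s ∈ S, 2 * (bad id s t : ℝ) := sum_le_sum hterm
      _ ≤ ∑ s, 2 * (bad id s t : ℝ) :=
          sum_le_sum_of_subset_of_nonneg (subset_univ _) fun _ _ _ => by positivity
      _ = 2 * ∑ s, (bad id s t : ℝ) := by rw [← mul_sum]
      _ ≤ 2 * ((T : ℝ) ^ 2 * P) := by linarith
  calc |∑ s ∈ S, ((acc id t E : ℝ) - acc (rep s) t E)| / ((2 ^ n - 1) * P)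
      ≤ 2 * ((T : ℝ) ^ 2 * P) / ((2 ^ n - 1) * P) := div_le_div_of_nonneg_right hsum (by positivity)
    _ = 2 * (T : ℝ) ^ 2 / (2 ^ n - 1) := by
        field_simp

end SimonLB

end Literature.Computability.QuantumComplexity
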